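/-
Copyright: the b2b-balaban T⁴-continuum CRUX team, row NE7b OWNER lineage `t4-ne7b-p1` (gen 138). Project licence.
-/
import Mathlib.Analysis.InnerProductSpace.PiL2
import Mathlib.Analysis.Calculus.MeanValue
import Mathlib.Analysis.Calculus.Deriv.Pow

/-!
# TAYLOR EXTRACTION IN THE SUP-NORM LETTER FORMAT: after the 2-jet of a `C³` potential at `φ = 0` is EXTRACTED (the numbers `U(0)`,
# `U′(0)`, `U″(0)` — the local couplings), what is left on the small-field sup-ball of radius `ρ ≤ R` is controlled by the THIRD letter
# `K₃` alone: `|U″(φ)[a,b] − U″(0)[a,b]| ≤ ρK₃`, `|U′(φ)[h] − U′(0)[h] − U″(0)[φ,h]| ≤ ρ²K₃∕2`,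
# `|U(φ) − U(0) − U′(0)[φ] − ½U″(0)[φ,φ]| ≤ ρ³K₃∕6` (unit sup-ball test vectors) — the lower letters are DERIVED, never iterated; and for an
# EVEN potential (`U(−φ) = U(φ)`) the odd jets vanish identically: `U′(−φ) = −U′(φ)`, `U″(−φ) = U″(φ)`, `U‴(−φ) = −U‴(φ)`, so `U′(0) = 0`,
# `U‴(0) = 0` — the extraction removes only `U(0)` and `U″(0)`, and the cubic letter AT THE ORIGIN is zero (the (d10) format's «odd orders
# killed by symmetry»).  SCOPING (d10), the extraction half of (β4) at the order the class carries (row NE7b, node U5c; Mathlib only;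
# [folklore] one-variable calculus along segments)

Cell `pub-balaban`, sub-cell `t4`, spine estimate NE7b (`T4WeightBudget.RelWeightBound`; the cell's OWN estimate — NOT PRINTED in
[Bałaban 1983–89], NOT PROVED).  Crux-route work under `Spine/NE7b/` by the row OWNER (`t4-ne7b-p1` gen 138, file (432)) under FREEZE
(0)'s crux-prover clause; NOTHING of Bałaban's is named as a Lean object, valued or asserted; no `T4Continuum/Support` leaf typed; no
`def`, no notation; zero `sorry`.  Imports: Mathlib only (fast lane); the `C³` data `hUd, hU'd, hU''d` are the class's ((427) format), the
sup-norm third letter `hU₃` is (431)'s, met BY SHAPE.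

WHY ((430)'s verdict, (431)'s format).  The nine-sup-letter class fails the fixed-ball test because it CARRIES the relevant letters
(orders `≤ 3` at `d = 4`) through the steps, where they grow by `L^{4−k}`.  The located YES-format carries only the marginal∕irrelevant
letters and a small-field radius, EXTRACTS the relevant Taylor data at `φ = 0` into finitely many local couplings per step (renormalised
separately — the β-function's business), and DERIVES the lower letters of the remainder from the top letter and the radius.  THIS FILE is
that derivation at the order the tree's class has (`C³`, letter `K₃`): the three Taylor remainders after 2-jet extraction, with the sharp
constants `1, 1∕2, 1∕6`, by the fencing lemma with a polynomial majorant along the segment `s ↦ sφ`; and the symmetry half: for even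
`U` the first and third jets at the origin vanish, so a symmetric class needs to extract only even orders (at `C⁵`: `U(0), U″(0), U⁗(0)` —
vacuum energy, mass form, quartic coupling — with remainder `ρ⁵K₅∕120`; the `C⁵` tower is NOT in the class yet: located).

WHAT IS PROVED ([folklore]; `U, U′, U″, U‴ = U₃` the class's `C³` tower on `EuclideanSpace ℝ ι`; sup-balls `∀ x, |φ x| ≤ ρ`):
* §1 FENCING WITH A POLYNOMIAL MAJORANT: `abs_le_of_deriv_le_pow` (`g(0) = 0`, `|g′(s)| ≤ C s^m` on `[0,1)` ⟹ `|g(1)| ≤ C∕(m+1)`).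
* §2 JETS ALONG LINES: `hasDerivAt_line0` (`s ↦ U(φ+sv)`), `hasDerivAt_line1` (`s ↦ U′(φ+sv)[h]`), `hasDerivAt_line2` (`s ↦ U″(φ+sv)[h,k]`),
  with derivatives `U′(φ+sv)[v]`, `U″(φ+sv)[v,h]`, `U‴(φ+sv)[v,h,k]`.
* §3 THE THREE REMAINDERS AFTER 2-JET EXTRACTION (third letter `K₃` on the `R`-ball, `0 < ρ ≤ R`, unit test vectors): **`remainder2`**
  (`|U″(φ)[a,b] − U″(0)[a,b]| ≤ ρK₃`), **`remainder1`** (`|U′(φ)[h] − U′(0)[h] − U″(0)[φ,h]| ≤ ρ²K₃∕2`), **`remainder0`**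
  (`|U(φ) − U(0) − U′(0)[φ] − ½U″(0)[φ,φ]| ≤ ρ³K₃∕6`).
* §4 EVEN POTENTIALS: `deriv_zero_of_even` (1-D: `g(−s) = g(s)`, `HasDerivAt g d 0 ⟹ d = 0`), `grad_odd` (`U′(−φ)[h] = −U′(φ)[h]`), `hess_even`
  (`U″(−φ)[k,h] = U″(φ)[k,h]`), `third_odd` (`U‴(−φ)[a,h,k] = −U‴(φ)[a,h,k]`), **`odd_jets_vanish`** (`U′(0) = 0 ∧ U‴(0) = 0`),
  `remainder0_even` (even `U`: `|U(φ) − U(0) − ½U″(0)[φ,φ]| ≤ ρ³K₃∕6`).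
* §5 toy (kernel): `g(s) = s²` is even with `g′(0) = 0`.

HONEST (what this is NOT).  Orders `≤ 3` only (the class is `C³`); the `C⁵` version (extract `U⁗(0)` too, remainder `ρ⁵K₅∕120`,
the marginal quartic carried as a coupling) is the same pattern two levels up and needs `U₄, U₅` in the class — located, not typed.
The FLOW of the extracted couplings (mass renormalisation, β-function), the fluctuation step in sup-norm letters ((β3′)), and
large-field suppression beyond the radius ((β4)) are NOT here.  Scalar skeleton ((A3), NC-NE7b-α UNRULED); nothing of Bałaban's
asserted.  BY-NAME EFFECT ON THE WALL: NONE.  NE7b NOT PRINTED ∕ NOT PROVED; spine PROVED 0∕9; rung (B)+1 — the programme's measures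
remain FINITE-torus statements; NOT the mass gap, NOT Clay.  HONEST DEPENDENCY: continuum YM on T⁴ ⇐ BetaPertH ∧ nine spine estimates
(0∕9 proved); BetaPertH ⇐ (D1) ∧ (D4) ∧ CAP+tail; G-an2-4 gates asym, D1 and NE2∕3∕4.
-/

set_option autoImplicit false
set_option maxSynthPendingDepth 3

noncomputable section

namespace Summit.QuantumFields.BalabanUV.T4Continuum.NE7b.SupTaylorExtractionLetters

open Set Real

variable {ι : Type} [Fintype ι]

variable {U : EuclideanSpace ℝ ι → ℝ} {U' : EuclideanSpace ℝ ι → EuclideanSpace ℝ ι →L[ℝ] ℝ}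
  {U'' : EuclideanSpace ℝ ι → EuclideanSpace ℝ ι →L[ℝ] EuclideanSpace ℝ ι →L[ℝ] ℝ}
  {U₃ : EuclideanSpace ℝ ι → EuclideanSpace ℝ ι →L[ℝ] EuclideanSpace ℝ ι →L[ℝ] EuclideanSpace ℝ ι →L[ℝ] ℝ}
  {K₃ R ρ : ℝ}

/-! ## §1. Fencing with a polynomial majorant -/

omit [Fintype ι] in
/-- **FENCING**: a real function with `g(0) = 0` and `|g′(s)| ≤ C·s^m` on `[0,1)` has `|g(1)| ≤ C∕(m+1)` (the majorant
`B(s) = C s^{m+1}∕(m+1)`). [folklore] -/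
theorem abs_le_of_deriv_le_pow {g g' : ℝ → ℝ} {C : ℝ} (m : ℕ) (hg : ∀ s, HasDerivAt g (g' s) s) (hg0 : g 0 = 0)
    (hbound : ∀ s ∈ Ico (0 : ℝ) 1, |g' s| ≤ C * s ^ m) : |g 1| ≤ C / (m + 1) := by
  have hm : ((m : ℝ) + 1) ≠ 0 := by positivity
  have hB : ∀ s : ℝ, HasDerivAt (fun s : ℝ => C * s ^ (m + 1) / ((m : ℝ) + 1)) (C * s ^ m) s := by
    intro s
    refine (((hasDerivAt_pow (m + 1) s).const_mul C).div_const ((m : ℝ) + 1)).congr_deriv ?_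
    simp only [Nat.add_sub_cancel, Nat.cast_add, Nat.cast_one]
    field_simp
  have key := image_norm_le_of_norm_deriv_right_le_deriv_boundary (f := g) (f' := g') (a := 0) (b := 1)
    (fun s _ => (hg s).continuousAt.continuousWithinAt) (fun s _ => (hg s).hasDerivWithinAt)
    (B := fun s : ℝ => C * s ^ (m + 1) / ((m : ℝ) + 1)) (B' := fun s => C * s ^ m) (by simp [hg0]) hB
    (fun s hs => by rw [Real.norm_eq_abs]; exact hbound s hs)
  have h1 := key (right_mem_Icc.2 zero_le_one)
  simpa [Real.norm_eq_abs] using h1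

/-! ## §2. Jets along lines -/

/-- `s ↦ U(φ + s•v)` has derivative `U′(φ+sv)[v]`. [folklore] -/
theorem hasDerivAt_line0 (hUd : ∀ ψ : EuclideanSpace ℝ ι, HasFDerivAt U (U' ψ) ψ) (φ v : EuclideanSpace ℝ ι) (s : ℝ) :
    HasDerivAt (fun s : ℝ => U (φ + s • v)) (U' (φ + s • v) v) s := by
  have hl : HasDerivAt (fun s : ℝ => φ + s • v) v s := by simpa using ((hasDerivAt_id s).smul_const v).const_add φ
  have h1 := (hUd (φ + s • v)).comp_hasDerivAt s hl
  simpa [Function.comp_def] using h1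

/-- `s ↦ U′(φ + s•v)[h]` has derivative `U″(φ+sv)[v,h]`. [folklore] -/
theorem hasDerivAt_line1 (hU'd : ∀ ψ : EuclideanSpace ℝ ι, HasFDerivAt U' (U'' ψ) ψ) (φ v h : EuclideanSpace ℝ ι) (s : ℝ) :
    HasDerivAt (fun s : ℝ => U' (φ + s • v) h) (U'' (φ + s • v) v h) s := by
  have hl : HasDerivAt (fun s : ℝ => φ + s • v) v s := by simpa using ((hasDerivAt_id s).smul_const v).const_add φ
  have h1 := (hU'd (φ + s • v)).comp_hasDerivAt s hl
  have h2 := (ContinuousLinearMap.apply ℝ ℝ h).hasFDerivAt.comp_hasDerivAt s h1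
  simpa [Function.comp_def] using h2

/-- `s ↦ U″(φ + s•v)[h,k]` has derivative `U‴(φ+sv)[v,h,k]`. [folklore] -/
theorem hasDerivAt_line2 (hU''d : ∀ ψ : EuclideanSpace ℝ ι, HasFDerivAt U'' (U₃ ψ) ψ) (φ v h k : EuclideanSpace ℝ ι) (s : ℝ) :
    HasDerivAt (fun s : ℝ => U'' (φ + s • v) h k) (U₃ (φ + s • v) v h k) s := by
  have hl : HasDerivAt (fun s : ℝ => φ + s • v) v s := by simpa using ((hasDerivAt_id s).smul_const v).const_add φ
  have h1 := (hU''d (φ + s • v)).comp_hasDerivAt s hl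
  have h2 := ((ContinuousLinearMap.apply ℝ ℝ k).comp (ContinuousLinearMap.apply ℝ (EuclideanSpace ℝ ι →L[ℝ] ℝ) h)).hasFDerivAt.comp_hasDerivAt s h1
  simpa [Function.comp_def] using h2

/-! ## §3. The three remainders after 2-jet extraction -/

omit [Fintype ι] in
/-- A point of the `ρ`-sup-ball scaled by `s ∈ [0,1]` lies in the `sρ`-sup-ball. [folklore] -/
theorem abs_smul_apply_le {φ : EuclideanSpace ℝ ι} (hφ : ∀ x, |φ x| ≤ ρ) {s : ℝ} (hs : 0 ≤ s) : ∀ x, |(s • φ) x| ≤ s * ρ := by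
  intro x
  rw [PiLp.smul_apply, smul_eq_mul, abs_mul, abs_of_nonneg hs]
  exact mul_le_mul_of_nonneg_left (hφ x) hs

omit [Fintype ι] in
/-- The normalised field `ρ⁻¹ • φ` lies in the unit sup-ball when `φ` lies in the `ρ`-ball (`ρ > 0`). [folklore] -/
theorem abs_inv_smul_apply_le {φ : EuclideanSpace ℝ ι} (hφ : ∀ x, |φ x| ≤ ρ) (hρ : 0 < ρ) : ∀ x, |(ρ⁻¹ • φ) x| ≤ 1 := by
  intro x
  rw [PiLp.smul_apply, smul_eq_mul, abs_mul, abs_of_nonneg (inv_nonneg.2 hρ.le), inv_mul_le_iff₀ hρ, mul_one]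
  exact hφ x

/-- **REMAINDER AT ORDER 2**: `|U″(φ)[a,b] − U″(0)[a,b]| ≤ ρ·K₃` for `|φ|_∞ ≤ ρ`, `0 < ρ ≤ R`, unit `a, b`, when `|U‴| ≤ K₃` on the `R`-ball
(mean value along `s ↦ sφ`; after extracting `U″(0)` the quadratic letter is `ρK₃`). [folklore] -/
theorem remainder2 (hU''d : ∀ ψ : EuclideanSpace ℝ ι, HasFDerivAt U'' (U₃ ψ) ψ)
    (hU₃ : ∀ ψ a b c : EuclideanSpace ℝ ι, (∀ x, |ψ x| ≤ R) → (∀ x, |a x| ≤ 1) → (∀ x, |b x| ≤ 1) → (∀ x, |c x| ≤ 1) → |U₃ ψ a b c| ≤ K₃)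
    (hρ : 0 < ρ) (hρR : ρ ≤ R) :
    ∀ φ a b : EuclideanSpace ℝ ι, (∀ x, |φ x| ≤ ρ) → (∀ x, |a x| ≤ 1) → (∀ x, |b x| ≤ 1) → |U'' φ a b - U'' 0 a b| ≤ ρ * K₃ := by
  intro φ a b hφ ha hb
  have hderiv : ∀ s, HasDerivAt (fun s : ℝ => U'' (s • φ) a b) (U₃ (s • φ) φ a b) s := by
    intro s
    simpa using hasDerivAt_line2 hU''d 0 φ a b s
  have hg : ∀ s, HasDerivAt (fun s : ℝ => U'' (s • φ) a b - U'' 0 a b) (U₃ (s • φ) φ a b) s := fun s => (hderiv s).sub_const _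
  have hbound : ∀ s ∈ Ico (0 : ℝ) 1, |U₃ (s • φ) φ a b| ≤ ρ * K₃ * s ^ 0 := by
    intro s hs
    have hsφ : ∀ x, |(s • φ) x| ≤ R := fun x =>
      (abs_smul_apply_le hφ hs.1 x).trans ((mul_le_of_le_one_left hρ.le hs.2.le).trans hρR)
    have h1 : U₃ (s • φ) φ a b = ρ * U₃ (s • φ) (ρ⁻¹ • φ) a b := by
      rw [map_smul,
        show ∀ (X : EuclideanSpace ℝ ι →L[ℝ] EuclideanSpace ℝ ι →L[ℝ] ℝ) (c : ℝ), (c • X) a b = c * X a b from fun X c => rfl]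
      field_simp
    rw [h1, abs_mul, abs_of_pos hρ, pow_zero, mul_one]
    exact mul_le_mul_of_nonneg_left (hU₃ _ _ _ _ hsφ (abs_inv_smul_apply_le hφ hρ) ha hb) hρ.le
  have h := abs_le_of_deriv_le_pow 0 hg (by simp) hbound
  simpa using h

/-- **REMAINDER AT ORDER 1**: `|U′(φ)[h] − U′(0)[h] − U″(0)[φ,h]| ≤ ρ²K₃∕2` for `|φ|_∞ ≤ ρ`, `0 < ρ ≤ R`, unit `h` (fencing with the
majorant `ρ²K₃·s²∕2` along `s ↦ sφ`, the derivative bound being §3's order-2 remainder at radius `sρ`). [folklore] -/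
theorem remainder1 (hU'd : ∀ ψ : EuclideanSpace ℝ ι, HasFDerivAt U' (U'' ψ) ψ) (hU''d : ∀ ψ : EuclideanSpace ℝ ι, HasFDerivAt U'' (U₃ ψ) ψ)
    (hU₃ : ∀ ψ a b c : EuclideanSpace ℝ ι, (∀ x, |ψ x| ≤ R) → (∀ x, |a x| ≤ 1) → (∀ x, |b x| ≤ 1) → (∀ x, |c x| ≤ 1) → |U₃ ψ a b c| ≤ K₃)
    (hρ : 0 < ρ) (hρR : ρ ≤ R) :
    ∀ φ h : EuclideanSpace ℝ ι, (∀ x, |φ x| ≤ ρ) → (∀ x, |h x| ≤ 1) → |U' φ h - U' 0 h - U'' 0 φ h| ≤ ρ ^ 2 * K₃ / 2 := by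
  intro φ h hφ hh
  -- the function `g(s) = U′(sφ)[h] − U′(0)[h] − s·U″(0)[φ,h]` and its derivative
  have hd1 : ∀ s, HasDerivAt (fun s : ℝ => U' (s • φ) h) (U'' (s • φ) φ h) s := by
    intro s
    simpa using hasDerivAt_line1 hU'd 0 φ h s
  have hg : ∀ s, HasDerivAt (fun s : ℝ => U' (s • φ) h - U' 0 h - s * U'' 0 φ h) (U'' (s • φ) φ h - U'' 0 φ h) s := by
    intro s
    have h2 : HasDerivAt (fun s : ℝ => s * U'' 0 φ h) (U'' 0 φ h) s := by simpa using (hasDerivAt_id s).mul_const (U'' 0 φ h)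
    exact ((hd1 s).sub_const _).sub h2
  have hbound : ∀ s ∈ Ico (0 : ℝ) 1, |U'' (s • φ) φ h - U'' 0 φ h| ≤ ρ ^ 2 * K₃ * s ^ 1 := by
    intro s hs
    rcases hs.1.eq_or_lt with h0 | hspos
    · rw [← h0]; simp
    -- at radius `sρ`: the order-2 remainder with `a = φ∕ρ`
    have hsρ : 0 < s * ρ := mul_pos hspos hρ
    have hsρR : s * ρ ≤ R := (mul_le_of_le_one_left hρ.le hs.2.le).trans hρR
    have hr2 := remainder2 hU''d hU₃ hsρ hsρR (s • φ) (ρ⁻¹ • φ) h (abs_smul_apply_le hφ hs.1) (abs_inv_smul_apply_le hφ hρ) hh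
    have h1 : U'' (s • φ) φ h - U'' 0 φ h = ρ * (U'' (s • φ) (ρ⁻¹ • φ) h - U'' 0 (ρ⁻¹ • φ) h) := by
      rw [map_smul, map_smul,
        show ∀ (f : EuclideanSpace ℝ ι →L[ℝ] ℝ) (c : ℝ), (c • f) h = c * f h from fun f c => rfl,
        show ∀ (f : EuclideanSpace ℝ ι →L[ℝ] ℝ) (c : ℝ), (c • f) h = c * f h from fun f c => rfl]
      field_simp
    rw [h1, abs_mul, abs_of_pos hρ, pow_one]
    calc ρ * |U'' (s • φ) (ρ⁻¹ • φ) h - U'' 0 (ρ⁻¹ • φ) h| ≤ ρ * (s * ρ * K₃) := mul_le_mul_of_nonneg_left hr2 hρ.le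
      _ = ρ ^ 2 * K₃ * s := by ring
  have hfin := abs_le_of_deriv_le_pow 1 hg (by simp) hbound
  have e1 : U' φ h - U' 0 h - U'' 0 φ h = (fun s : ℝ => U' (s • φ) h - U' 0 h - s * U'' 0 φ h) 1 := by
    simp only [one_smul]; ring
  rw [e1]
  refine hfin.trans (le_of_eq ?_)
  push_cast
  ring

/-- **REMAINDER AT ORDER 0**: `|U(φ) − U(0) − U′(0)[φ] − ½U″(0)[φ,φ]| ≤ ρ³K₃∕6` for `|φ|_∞ ≤ ρ`, `0 < ρ ≤ R` (fencing with the majorant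
`ρ³K₃·s³∕6`, the derivative bound being the order-1 remainder at radius `sρ`). [folklore] -/
theorem remainder0 (hUd : ∀ ψ : EuclideanSpace ℝ ι, HasFDerivAt U (U' ψ) ψ) (hU'd : ∀ ψ : EuclideanSpace ℝ ι, HasFDerivAt U' (U'' ψ) ψ)
    (hU''d : ∀ ψ : EuclideanSpace ℝ ι, HasFDerivAt U'' (U₃ ψ) ψ)
    (hU₃ : ∀ ψ a b c : EuclideanSpace ℝ ι, (∀ x, |ψ x| ≤ R) → (∀ x, |a x| ≤ 1) → (∀ x, |b x| ≤ 1) → (∀ x, |c x| ≤ 1) → |U₃ ψ a b c| ≤ K₃)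
    (hρ : 0 < ρ) (hρR : ρ ≤ R) :
    ∀ φ : EuclideanSpace ℝ ι, (∀ x, |φ x| ≤ ρ) → |U φ - U 0 - U' 0 φ - U'' 0 φ φ / 2| ≤ ρ ^ 3 * K₃ / 6 := by
  intro φ hφ
  have hd0 : ∀ s, HasDerivAt (fun s : ℝ => U (s • φ)) (U' (s • φ) φ) s := by
    intro s
    simpa using hasDerivAt_line0 hUd 0 φ s
  have hg : ∀ s, HasDerivAt (fun s : ℝ => U (s • φ) - U 0 - s * U' 0 φ - s ^ 2 / 2 * U'' 0 φ φ)
      (U' (s • φ) φ - U' 0 φ - s * U'' 0 φ φ) s := by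
    intro s
    have h1 : HasDerivAt (fun s : ℝ => s * U' 0 φ) (U' 0 φ) s := by simpa using (hasDerivAt_id s).mul_const (U' 0 φ)
    have h2 : HasDerivAt (fun s : ℝ => s ^ 2 / 2 * U'' 0 φ φ) (s * U'' 0 φ φ) s := by
      refine (((hasDerivAt_pow 2 s).div_const 2).mul_const (U'' 0 φ φ)).congr_deriv ?_
      simp only [Nat.cast_ofNat, Nat.add_one_sub_one, pow_one]
      ring
    exact (((hd0 s).sub_const _).sub h1).sub h2
  have hbound : ∀ s ∈ Ico (0 : ℝ) 1, |U' (s • φ) φ - U' 0 φ - s * U'' 0 φ φ| ≤ ρ ^ 3 * K₃ / 2 * s ^ 2 := by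
    intro s hs
    rcases hs.1.eq_or_lt with h0 | hspos
    · rw [← h0]; simp
    have hsρ : 0 < s * ρ := mul_pos hspos hρ
    have hsρR : s * ρ ≤ R := (mul_le_of_le_one_left hρ.le hs.2.le).trans hρR
    have hr1 := remainder1 hU'd hU''d hU₃ hsρ hsρR (s • φ) (ρ⁻¹ • φ) (abs_smul_apply_le hφ hs.1) (abs_inv_smul_apply_le hφ hρ)
    have eφ : ρ • (ρ⁻¹ • φ) = φ := by rw [smul_smul, mul_inv_cancel₀ hρ.ne', one_smul]
    have e1 : U' (s • φ) φ = ρ * U' (s • φ) (ρ⁻¹ • φ) := by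
      have := (U' (s • φ)).map_smul ρ (ρ⁻¹ • φ)
      rw [eφ] at this
      rw [this, smul_eq_mul]
    have e2 : U' 0 φ = ρ * U' 0 (ρ⁻¹ • φ) := by
      have := (U' 0).map_smul ρ (ρ⁻¹ • φ)
      rw [eφ] at this
      rw [this, smul_eq_mul]
    have e3 : U'' 0 (s • φ) (ρ⁻¹ • φ) = s * (ρ⁻¹ * U'' 0 φ φ) := by
      have ha : U'' 0 (s • φ) (ρ⁻¹ • φ) = s * U'' 0 φ (ρ⁻¹ • φ) := by rw [(U'' 0).map_smul s φ]; rfl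
      have hb : U'' 0 φ (ρ⁻¹ • φ) = ρ⁻¹ * U'' 0 φ φ := by rw [map_smul, smul_eq_mul]
      rw [ha, hb]
    have h1 : U' (s • φ) φ - U' 0 φ - s * U'' 0 φ φ = ρ * (U' (s • φ) (ρ⁻¹ • φ) - U' 0 (ρ⁻¹ • φ) - U'' 0 (s • φ) (ρ⁻¹ • φ)) := by
      rw [e1, e2, e3]
      field_simp
    rw [h1, abs_mul, abs_of_pos hρ]
    calc ρ * |U' (s • φ) (ρ⁻¹ • φ) - U' 0 (ρ⁻¹ • φ) - U'' 0 (s • φ) (ρ⁻¹ • φ)| ≤ ρ * ((s * ρ) ^ 2 * K₃ / 2) :=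
          mul_le_mul_of_nonneg_left hr1 hρ.le
      _ = ρ ^ 3 * K₃ / 2 * s ^ 2 := by ring
  have hfin := abs_le_of_deriv_le_pow 2 hg (by simp) hbound
  have e1 : U φ - U 0 - U' 0 φ - U'' 0 φ φ / 2 = (fun s : ℝ => U (s • φ) - U 0 - s * U' 0 φ - s ^ 2 / 2 * U'' 0 φ φ) 1 := by
    simp only [one_smul]; ring
  rw [e1]
  refine hfin.trans (le_of_eq ?_)
  push_cast
  ring

/-! ## §4. Even potentials: odd jets vanish -/

omit [Fintype ι] in
/-- **An even differentiable real function has zero derivative at the origin.** [folklore] -/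
theorem deriv_zero_of_even {g : ℝ → ℝ} {d : ℝ} (heven : ∀ s, g (-s) = g s) (hd : HasDerivAt g d 0) : d = 0 := by
  have h1 : HasDerivAt (g ∘ fun s : ℝ => -s) ((-1 : ℝ) • d) 0 := HasDerivAt.scomp (0 : ℝ) (by simpa using hd) (hasDerivAt_neg' (0 : ℝ))
  have hfun : (g ∘ fun s : ℝ => -s) = g := funext fun s => heven s
  rw [hfun] at h1
  have h2 := hd.unique h1
  simp only [smul_eq_mul, neg_mul, one_mul] at h2
  linarith

/-- **The gradient of an even potential is odd**: `U′(−φ)[h] = −U′(φ)[h]`. [folklore] -/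
theorem grad_odd (hUd : ∀ ψ : EuclideanSpace ℝ ι, HasFDerivAt U (U' ψ) ψ) (heven : ∀ φ : EuclideanSpace ℝ ι, U (-φ) = U φ)
    (φ h : EuclideanSpace ℝ ι) : U' (-φ) h = -(U' φ h) := by
  have h1 : HasDerivAt (fun s : ℝ => U (φ + s • h)) (U' (φ + (0 : ℝ) • h) h) 0 := hasDerivAt_line0 hUd φ h 0
  have h2 : HasDerivAt (fun s : ℝ => U (-φ + s • (-h))) (U' (-φ + (0 : ℝ) • (-h)) (-h)) 0 := hasDerivAt_line0 hUd (-φ) (-h) 0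
  have hfun : (fun s : ℝ => U (-φ + s • (-h))) = fun s : ℝ => U (φ + s • h) := by
    funext s
    rw [show -φ + s • (-h) = -(φ + s • h) by rw [smul_neg, neg_add], heven]
  rw [hfun] at h2
  have h3 := h1.unique h2
  simp only [zero_smul, add_zero, map_neg] at h3
  linarith

/-- **The Hessian of an even potential is even**: `U″(−φ)[k,h] = U″(φ)[k,h]`. [folklore] -/
theorem hess_even (hUd : ∀ ψ : EuclideanSpace ℝ ι, HasFDerivAt U (U' ψ) ψ) (hU'd : ∀ ψ : EuclideanSpace ℝ ι, HasFDerivAt U' (U'' ψ) ψ)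
    (heven : ∀ φ : EuclideanSpace ℝ ι, U (-φ) = U φ) (φ k h : EuclideanSpace ℝ ι) : U'' (-φ) k h = U'' φ k h := by
  have h1 : HasDerivAt (fun s : ℝ => U' (φ + s • k) h) (U'' (φ + (0 : ℝ) • k) k h) 0 := hasDerivAt_line1 hU'd φ k h 0
  have h2 : HasDerivAt (fun s : ℝ => -(U' (-φ + s • (-k)) h)) (-(U'' (-φ + (0 : ℝ) • (-k)) (-k) h)) 0 :=
    (hasDerivAt_line1 hU'd (-φ) (-k) h 0).neg
  have hfun : (fun s : ℝ => -(U' (-φ + s • (-k)) h)) = fun s : ℝ => U' (φ + s • k) h := by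
    funext s
    rw [show -φ + s • (-k) = -(φ + s • k) by rw [smul_neg, neg_add], grad_odd hUd heven, neg_neg]
  rw [hfun] at h2
  have h3 := h1.unique h2
  simp only [zero_smul, add_zero, map_neg] at h3
  rw [show ∀ (f : EuclideanSpace ℝ ι →L[ℝ] ℝ), (-f) h = -(f h) from fun f => rfl, neg_neg] at h3
  exact h3.symm

/-- **The third derivative of an even potential is odd**: `U‴(−φ)[a,h,k] = −U‴(φ)[a,h,k]`. [folklore] -/
theorem third_odd (hUd : ∀ ψ : EuclideanSpace ℝ ι, HasFDerivAt U (U' ψ) ψ) (hU'd : ∀ ψ : EuclideanSpace ℝ ι, HasFDerivAt U' (U'' ψ) ψ)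
    (hU''d : ∀ ψ : EuclideanSpace ℝ ι, HasFDerivAt U'' (U₃ ψ) ψ) (heven : ∀ φ : EuclideanSpace ℝ ι, U (-φ) = U φ)
    (φ a h k : EuclideanSpace ℝ ι) : U₃ (-φ) a h k = -(U₃ φ a h k) := by
  have h1 : HasDerivAt (fun s : ℝ => U'' (φ + s • a) h k) (U₃ (φ + (0 : ℝ) • a) a h k) 0 := hasDerivAt_line2 hU''d φ a h k 0
  have h2 : HasDerivAt (fun s : ℝ => U'' (-φ + s • (-a)) h k) (U₃ (-φ + (0 : ℝ) • (-a)) (-a) h k) 0 := hasDerivAt_line2 hU''d (-φ) (-a) h k 0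
  have hfun : (fun s : ℝ => U'' (-φ + s • (-a)) h k) = fun s : ℝ => U'' (φ + s • a) h k := by
    funext s
    rw [show -φ + s • (-a) = -(φ + s • a) by rw [smul_neg, neg_add], hess_even hUd hU'd heven]
  rw [hfun] at h2
  have h3 := h1.unique h2
  simp only [zero_smul, add_zero, map_neg] at h3
  rw [show ∀ (X : EuclideanSpace ℝ ι →L[ℝ] EuclideanSpace ℝ ι →L[ℝ] ℝ), (-X) h k = -(X h k) from fun X => rfl] at h3
  linarith

/-- **ODD JETS OF AN EVEN POTENTIAL VANISH AT THE ORIGIN**: `U′(0) = 0` and `U‴(0) = 0` — for a symmetric class the extraction at `0`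
removes only the even orders, and the cubic letter at the origin is zero. [folklore] -/
theorem odd_jets_vanish (hUd : ∀ ψ : EuclideanSpace ℝ ι, HasFDerivAt U (U' ψ) ψ) (hU'd : ∀ ψ : EuclideanSpace ℝ ι, HasFDerivAt U' (U'' ψ) ψ)
    (hU''d : ∀ ψ : EuclideanSpace ℝ ι, HasFDerivAt U'' (U₃ ψ) ψ) (heven : ∀ φ : EuclideanSpace ℝ ι, U (-φ) = U φ) :
    U' 0 = 0 ∧ U₃ 0 = 0 := by
  refine ⟨?_, ?_⟩
  · ext h
    have h1 := grad_odd hUd heven 0 h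
    rw [neg_zero] at h1
    have h2 : U' 0 h = 0 := by linarith
    simpa using h2
  · ext a h k
    have h1 := third_odd hUd hU'd hU''d heven 0 a h k
    rw [neg_zero] at h1
    have h2 : U₃ 0 a h k = 0 := by linarith
    simpa using h2

/-- **THE REMAINDER OF AN EVEN POTENTIAL**: `|U(φ) − U(0) − ½U″(0)[φ,φ]| ≤ ρ³K₃∕6` on the `ρ`-sup-ball (`0 < ρ ≤ R`) — only `U(0)` and the
mass form `U″(0)` are extracted. [folklore] -/
theorem remainder0_even (hUd : ∀ ψ : EuclideanSpace ℝ ι, HasFDerivAt U (U' ψ) ψ) (hU'd : ∀ ψ : EuclideanSpace ℝ ι, HasFDerivAt U' (U'' ψ) ψ)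
    (hU''d : ∀ ψ : EuclideanSpace ℝ ι, HasFDerivAt U'' (U₃ ψ) ψ)
    (hU₃ : ∀ ψ a b c : EuclideanSpace ℝ ι, (∀ x, |ψ x| ≤ R) → (∀ x, |a x| ≤ 1) → (∀ x, |b x| ≤ 1) → (∀ x, |c x| ≤ 1) → |U₃ ψ a b c| ≤ K₃)
    (heven : ∀ φ : EuclideanSpace ℝ ι, U (-φ) = U φ) (hρ : 0 < ρ) (hρR : ρ ≤ R) :
    ∀ φ : EuclideanSpace ℝ ι, (∀ x, |φ x| ≤ ρ) → |U φ - U 0 - U'' 0 φ φ / 2| ≤ ρ ^ 3 * K₃ / 6 := by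
  intro φ hφ
  have h := remainder0 hUd hU'd hU''d hU₃ hρ hρR φ hφ
  rw [(odd_jets_vanish hUd hU'd hU''d heven).1] at h
  simpa using h

/-! ## §5. Toy -/

/-- Toy (kernel): `g(s) = s²` is even, so its derivative at `0` (which is `2·0 = 0`) vanishes by §4. -/
example : (2 : ℝ) * 0 = 0 :=
  deriv_zero_of_even (g := fun s : ℝ => s ^ 2) (fun s => by ring) (by simpa using hasDerivAt_pow 2 (0 : ℝ))

end Summit.QuantumFields.BalabanUV.T4Continuum.NE7b.SupTaylorExtractionLetters

end
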